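/-
Copyright (c) 2026. All rights reserved.
Released under Apache 2.0 license as described in the file LICENSE.
Authors: abc-iut cell, seat abc-iut-L6-t6 (the last sentence of [IUTchIII] Example 3.6 (iii), part 2:
rigidity on the perfection).
-/
import Literature.IUT.LogThetaLattice.GlobalFrobenioidModelsFrobenioid
import Literature.AlgebraicGeometry.Frobenioids.PerfectionFunctoriality
import Mathlib.GroupTheory.OrderOfElement
import HarnessLib

/-!
# [IUTchIII] Example 3.6 (iii), last sentence — part 2: on THE PERFECTION of `𝓕⊛_𝔪𝔬𝔡` an isomorphism of
# Frobenioids is completely determined by its effect on objects, Frobenius degrees and `F^×_mod` up to torsion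

S. Mochizuki, *Inter-universal Teichmüller Theory III*, kurims manuscript (May 2020), Example 3.6 (iii),
p. 108 l. 22–27 [claim key Mochizuki2012, status disputed (D-0012)]: "One verifies immediately that although
the above isomorphism of Frobenioids is not necessarily determined by the condition that it induce the identity
morphism on `F^×_mod`, the induced isomorphism between the respective perfections [hence also on realifications]
of `𝓕⊛_𝔪𝔬𝔡`, `𝓕⊛_MOD` is completely determined by this condition."

Part 1 (`GlobalFrobenioidModelsUnitTwist.lean`, abc-iut-L6-t6) exhibits the indeterminacy BEFORE perfection: the
unit twists `Ψ_u` of `𝓕⊛_𝔪𝔬𝔡` (`(n, f) ↦ (n, u·f·u^{−n})`, `u` a unit at every place) fix objects, Frobenius degrees,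
the Frobenioid structure and every linear morphism, but are `≠ 𝟭`. THIS proof-only file is the mechanism of
the second half, for THE perfection `C^pf` of [FrdI] Def. 3.1 (iii) as built by abc-iut-L1-d9
(`PreFrobenioid.Perfection`, functoriality `Perfection.map` of `PerfectionFunctoriality.lean`):

**Rigidity theorem** (`FrakCat.perfection_map_eq_of_isOfFinOrder`). Let `C` be any Frobenioid and
`Ψ, Ψ' : C → 𝓕⊛_𝔪𝔬𝔡` Frobenius-compatible functors (so that `Ψ^pf, Ψ'^pf : C^pf → (𝓕⊛_𝔪𝔬𝔡)^pf` are defined) which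
agree on objects and on Frobenius degrees, and whose rational-function components differ, on every morphism,
by an element of `F^×_mod` of FINITE ORDER: `fn(Ψ' θ) / fn(Ψ θ)` torsion. Then `Ψ'^pf = Ψ^pf` as functors.
(For an isomorphism of Frobenioids compatible with the Frobenioid structures the discrepancy has zero divisor,
i.e. lies in `⋂_v ker β_v` — at the number-field model the roots of unity of `F_mod`; "inducing the identity on
`F^×_mod`" kills it on linear morphisms but, as part 1 shows, not on morphisms of Frobenius degree `≥ 2`.)

Mechanism (the "immediate verification"): in `(𝓕⊛_𝔪𝔬𝔡)^pf` a perfected morphism `(𝔍₁, n) → (𝔍₂, m)` is represented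
at a level `(a, b)` by an arrow `θ = (k, g) : 𝔍₁^{(a)} → 𝔍₂^{(b)}`, and its transport to the level `(a·t, b·t)`
along the Frobenius-type transition morphisms `(t, w₁)`, `(t, w₂)` is `(k, w₂ · g^t · w₁^{−k})` (`FrakCat.fn_lift`):
two representatives `(k, g)`, `(k, ε·g)` with `ε^t = 1` therefore AGREE at level `·t`
(`FrakCat.mk_eq_mk_of_fn_eq_mul`) — torsion units die in the inductive limit. The comparison isomorphisms
`Ψ(A^{(a)}) ≅ (Ψ A)^{(a)}` entering `Ψ^pf` contribute further torsion discrepancies only (`fn_frobPowIso_hom`).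

The corollaries for the unit twists and for the twisted identifications `Ψ_u ⋙ toMOD` versus `toMOD`
(`(Ψ_u)^pf = 𝟭`, `(Ψ_u ⋙ toMOD)^pf = toMOD^pf`) are drawn in the sequel once part 1 is in the tree. READING and
HONEST FRAMING as in part 1: "determined" = equality of the induced functors given the action on objects;
elementary category theory of the tree's own model of Ex. 3.6 and of [FrdI] Def. 3.1; nothing here bears on
[IUTchIII] Cor. 3.12; typed ≠ endorsed.
-/

namespace Literature.IUT.LogThetaLattice

namespace GlobalFrobenioidModels

open CategoryTheory Opposite Literature.AlgebraicGeometry.Frobenioids PreFrobenioid PreFrobenioid.Perfection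

universe u w₁ v₁ v₁' u₁ u₁'

variable {F : Type u} [Field F] {V : Type u} {Γ : V → Type u} [∀ v, AddCommGroup (Γ v)]
  {nonneg : ∀ v, AddSubmonoid (Γ v)} {β : ∀ v, Additive Fˣ →+ Γ v}

namespace FrakCat

/-! ### Degrees and elements of isomorphisms of `𝓕⊛_𝔪𝔬𝔡` -/

/-- An isomorphism of `𝓕⊛_𝔪𝔬𝔡` has Frobenius degree `1`. ([IUTchIII] Ex 3.6 (ii) p.108) [claim: Mochizuki2012, status: disputed] -/
theorem deg_eq_one_of_isIso {X Y : FrakCat F V Γ nonneg β} (φ : X ⟶ Y) [IsIso φ] : deg φ = 1 := by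
  have h := congrArg deg (IsIso.hom_inv_id φ)
  rw [deg_comp, deg_id] at h
  exact (PNat.dvd_one_iff _).mp (Dvd.intro_left _ h)

/-- For an isomorphism `e` of `𝓕⊛_𝔪𝔬𝔡`, `fn e⁻¹ · fn e = 1`. ([IUTchIII] Ex 3.6 (ii) p.108) [claim: Mochizuki2012, status: disputed] -/
theorem fn_inv_mul_fn {X Y : FrakCat F V Γ nonneg β} (e : X ≅ Y) : fn e.inv * fn e.hom = 1 := by
  have h := congrArg fn e.hom_inv_id
  rwa [fn_comp, fn_id, deg_eq_one_of_isIso e.inv, PNat.one_coe, pow_one] at h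

/-- `fn e⁻¹ = (fn e)⁻¹`. ([IUTchIII] Ex 3.6 (ii) p.108) [claim: Mochizuki2012, status: disputed] -/
theorem fn_inv_eq {X Y : FrakCat F V Γ nonneg β} (e : X ≅ Y) : fn e.inv = (fn e.hom)⁻¹ :=
  eq_inv_of_mul_eq_one_left (fn_inv_mul_fn e)

/-! ### Transport of representatives in the perfection of `𝓕⊛_𝔪𝔬𝔡` -/

section Lift

variable {H : ModelHyps nonneg β} {hF : PreFrobenioid.IsFrobenioid (structureFunctor H)}

/-- Transport to a higher level does not change the Frobenius degree of a representative.
([IUTchIII] Ex 3.6 (iii) p.108) [claim: Mochizuki2012, status: disputed] -/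
theorem deg_lift {X Y : Perfection hF} (L M : Level X Y) (h : L.LE M) (θ : L.HomAt) :
    deg (Level.lift L M h θ) = deg θ := by
  have e := congrArg deg (Level.lift_spec L M h θ)
  rw [deg_comp, deg_comp] at e
  have hd : deg (frobTrans hF X.obj h.1) = deg (frobTrans hF Y.obj h.2) := Level.degFr_eq L M h
  rw [hd, mul_comm] at e
  exact mul_left_cancel e

/-- **Transport formula in `(𝓕⊛_𝔪𝔬𝔡)^pf`**: if `θ = (k, g)` and the transition morphisms are `(t, w₁)`, `(t, w₂)`,
the transport `θ′ = (k, g′)` satisfies `g′ · w₁^k = w₂ · g^t`. ([IUTchIII] Ex 3.6 (iii) p.108) [claim: Mochizuki2012, status: disputed] -/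
theorem fn_lift {X Y : Perfection hF} (L M : Level X Y) (h : L.LE M) (θ : L.HomAt) :
    fn (Level.lift L M h θ) * fn (frobTrans hF X.obj h.1) ^ (deg θ : ℕ) =
      fn (frobTrans hF Y.obj h.2) * fn θ ^ (deg (frobTrans hF Y.obj h.2) : ℕ) := by
  have e := congrArg fn (Level.lift_spec L M h θ)
  rwa [fn_comp, fn_comp, deg_lift] at e

/-- The transition morphism to the level `(a·t, b·t)` has Frobenius degree `t`.
([IUTchIII] Ex 3.6 (iii) p.108) [claim: Mochizuki2012, status: disputed] -/
theorem deg_frobTrans_mul (A : FrakCat F V Γ nonneg β) (b t : ℕ+) (h : b ∣ b * t) :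
    deg (frobTrans hF A h) = t :=
  mul_left_cancel (degFr_frobTrans hF A h)

/-- **Torsion units die in the perfection.** Two representatives at the same level with the same Frobenius
degree whose elements differ by `ε` with `ε^t = 1` define the same perfected morphism (they agree at the
level `·t`). ([IUTchIII] Ex 3.6 (iii) p.108) [claim: Mochizuki2012, status: disputed] -/
theorem mk_eq_mk_of_fn_eq_mul {X Y : Perfection hF} (L : Level X Y) (θ θ' : L.HomAt)
    (hdeg : deg θ' = deg θ) {ε : Fˣ} (hfn : fn θ' = ε * fn θ) {t : ℕ+} (hε : ε ^ (t : ℕ) = 1) :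
    Perfection.Hom.mk ⟨L, θ'⟩ = Perfection.Hom.mk ⟨L, θ⟩ := by
  apply Perfection.Hom.mk_eq_mk.mpr
  let M : Level X Y := ⟨L.a * t, L.b * t, by rw [← mul_assoc, L.eq, mul_assoc]⟩
  have hM : L.LE M := ⟨Dvd.intro t rfl, Dvd.intro t rfl⟩
  refine ⟨M, hM, hM, ?_⟩
  have hT : deg (frobTrans hF Y.obj hM.2) = t := deg_frobTrans_mul Y.obj L.b t hM.2
  have h₁ := fn_lift L M hM θ
  have h₂ := fn_lift L M hM θ'
  rw [hT] at h₁ h₂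
  rw [hdeg, hfn, mul_pow, hε, one_mul, ← h₁] at h₂
  show Level.lift L M hM θ' = Level.lift L M hM θ
  apply hom_ext
  · rw [deg_lift, deg_lift, hdeg]
  · exact mul_right_cancel h₂

/-- The same, across EQUAL objects of the perfection and for representatives given separately (the form used
for functors that agree on objects only propositionally). ([IUTchIII] Ex 3.6 (iii) p.108) [claim: Mochizuki2012, status: disputed] -/
theorem heq_mk_of_fn_eq_mul {X₁ Y₁ X₂ Y₂ : Perfection hF} (hX : X₁ = X₂) (hY : Y₁ = Y₂)
    (r₁ : Rep X₁ Y₁) (r₂ : Rep X₂ Y₂) (ha : r₁.L.a = r₂.L.a) (hb : r₁.L.b = r₂.L.b)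
    (hdeg : deg r₁.hom = deg r₂.hom) {ε : Fˣ} (hfn : fn r₁.hom = ε * fn r₂.hom) {t : ℕ+}
    (hε : ε ^ (t : ℕ) = 1) : HEq (Perfection.Hom.mk r₁) (Perfection.Hom.mk r₂) := by
  subst hX hY
  obtain ⟨⟨a₁, b₁, e₁⟩, θ₁⟩ := r₁
  obtain ⟨⟨a₂, b₂, e₂⟩, θ₂⟩ := r₂
  change a₁ = a₂ at ha
  change b₁ = b₂ at hb
  subst ha hb
  exact heq_of_eq (mk_eq_mk_of_fn_eq_mul ⟨a₁, b₁, e₁⟩ θ₂ θ₁ hdeg hfn hε)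

end Lift

/-! ### The rigidity theorem -/

section Rigidity

variable {H : ModelHyps nonneg β} {hF : PreFrobenioid.IsFrobenioid (structureFunctor H)}
  {D₁ : Type u₁} [Category.{v₁} D₁] {Φ₁ : D₁ᵒᵖ ⥤ CommMonCat.{w₁}} {C₁ : Type u₁'} [Category.{v₁'} C₁]
  {F₁ : C₁ ⥤ ElemFrobenioid Φ₁} {hF₁ : PreFrobenioid.IsFrobenioid F₁} {G G' : C₁ ⥤ FrakCat F V Γ nonneg β}
  (hG : IsFrobeniusCompatible F₁ (structureFunctor H) G) (hG' : IsFrobeniusCompatible F₁ (structureFunctor H) G')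

/-- The chosen Frobenius power `frob` only depends on the object (transport along an equality of objects).
([IUTchIII] Ex 3.6 (iii) p.108) [claim: Mochizuki2012, status: disputed] -/
theorem fn_frob_congr {A₁ A₂ : FrakCat F V Γ nonneg β} (h : A₁ = A₂) (a : ℕ+) :
    fn (frob hF A₁ a) = fn (frob hF A₂ a) := by
  subst h
  rfl

/-- The element of the comparison isomorphism `j : Ψ(A^{(a)}) ≅ (Ψ A)^{(a)}`: from `Ψ(frob_A) ≫ j = frob_{Ψ A}`,
`fn j = fn(frob_{Ψ A}) · fn(Ψ frob_A)⁻¹`. ([IUTchIII] Ex 3.6 (iii) p.108) [claim: Mochizuki2012, status: disputed] -/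
theorem fn_frobPowIso_hom (A : C₁) (a : ℕ+) :
    fn (frobPowIso (hF₁ := hF₁) (hF₂ := hF) hG A a).hom =
      fn (frob hF (G.obj A) a) * (fn (G.map (frob hF₁ A a)))⁻¹ := by
  have h := congrArg fn (map_frob_frobPowIso (hF₁ := hF₁) (hF₂ := hF) hG A a)
  rw [fn_comp, deg_eq_one_of_isIso (frobPowIso (hF₁ := hF₁) (hF₂ := hF) hG A a).hom, PNat.one_coe,
    pow_one] at h
  exact eq_mul_inv_of_mul_eq h

/-- The Frobenius degree of `Ψ^pf` on a representative is that of `Ψ` on it.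
([IUTchIII] Ex 3.6 (iii) p.108) [claim: Mochizuki2012, status: disputed] -/
theorem deg_repMap_hom {X Y : Perfection hF₁} (r : Rep X Y) :
    deg (repMap (hF₁ := hF₁) (hF₂ := hF) hG r).hom = deg (G.map r.hom) := by
  rw [repMap_hom, deg_comp, deg_comp, deg_eq_one_of_isIso (frobPowIso (hF₁ := hF₁) (hF₂ := hF) hG _ _).hom,
    deg_eq_one_of_isIso (frobPowIso (hF₁ := hF₁) (hF₂ := hF) hG _ _).inv, one_mul, mul_one]

/-- The element of `Ψ^pf` on a representative `θ`: `fn(j_Y) · fn(Ψ θ) · fn(j_X)^{−k}`, `k = deg(Ψ θ)`.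
([IUTchIII] Ex 3.6 (iii) p.108) [claim: Mochizuki2012, status: disputed] -/
theorem fn_repMap_hom {X Y : Perfection hF₁} (r : Rep X Y) :
    fn (repMap (hF₁ := hF₁) (hF₂ := hF) hG r).hom =
      fn (frobPowIso (hF₁ := hF₁) (hF₂ := hF) hG Y.obj r.L.b).hom * fn (G.map r.hom) *
        ((fn (frobPowIso (hF₁ := hF₁) (hF₂ := hF) hG X.obj r.L.a).hom)⁻¹) ^ (deg (G.map r.hom) : ℕ) := by
  rw [repMap_hom, fn_comp, fn_comp, deg_comp,
    deg_eq_one_of_isIso (frobPowIso (hF₁ := hF₁) (hF₂ := hF) hG _ _).hom, PNat.one_coe, pow_one, one_mul,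
    fn_inv_eq]

/-- **Rigidity of `(−)^pf` into `𝓕⊛_𝔪𝔬𝔡` ([IUTchIII] Ex. 3.6 (iii), last sentence).** Two Frobenius-compatible
functors `Ψ, Ψ' : C → 𝓕⊛_𝔪𝔬𝔡` from a Frobenioid that agree on objects and on Frobenius degrees and whose
rational-function components differ on every morphism by an element of finite order induce THE SAME functor
`C^pf → (𝓕⊛_𝔪𝔬𝔡)^pf` on the perfections. ([IUTchIII] Ex 3.6 (iii) p.108) [claim: Mochizuki2012, status: disputed] -/
theorem perfection_map_eq_of_isOfFinOrder (hobj : ∀ A, G'.obj A = G.obj A)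
    (hdeg : ∀ ⦃A B : C₁⦄ (θ : A ⟶ B), deg (G'.map θ) = deg (G.map θ))
    (hfn : ∀ ⦃A B : C₁⦄ (θ : A ⟶ B), IsOfFinOrder (fn (G'.map θ) / fn (G.map θ))) :
    Perfection.map (hF₁ := hF₁) (hF₂ := hF) hG' = Perfection.map (hF₁ := hF₁) (hF₂ := hF) hG := by
  refine CategoryTheory.Functor.hext (fun X => Perfection.ext (hobj X.obj) rfl) (fun X Y f => ?_)
  obtain ⟨r, rfl⟩ := Perfection.Hom.mk_surjective f
  -- the finite-order discrepancy between the two representatives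
  have eX : fn (frobPowIso (hF₁ := hF₁) (hF₂ := hF) hG X.obj r.L.a).hom /
      fn (frobPowIso (hF₁ := hF₁) (hF₂ := hF) hG' X.obj r.L.a).hom =
        fn (G'.map (frob hF₁ X.obj r.L.a)) / fn (G.map (frob hF₁ X.obj r.L.a)) := by
    rw [fn_frobPowIso_hom hG, fn_frobPowIso_hom hG', fn_frob_congr (hobj X.obj), mul_div_mul_left_eq_div,
      inv_div_inv]
  have eY : fn (frobPowIso (hF₁ := hF₁) (hF₂ := hF) hG' Y.obj r.L.b).hom /
      fn (frobPowIso (hF₁ := hF₁) (hF₂ := hF) hG Y.obj r.L.b).hom =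
        fn (G.map (frob hF₁ Y.obj r.L.b)) / fn (G'.map (frob hF₁ Y.obj r.L.b)) := by
    rw [fn_frobPowIso_hom hG, fn_frobPowIso_hom hG', fn_frob_congr (hobj Y.obj), mul_div_mul_left_eq_div,
      inv_div_inv]
  have key : IsOfFinOrder (fn (repMap (hF₁ := hF₁) (hF₂ := hF) hG' r).hom /
      fn (repMap (hF₁ := hF₁) (hF₂ := hF) hG r).hom) := by
    rw [fn_repMap_hom hG', fn_repMap_hom hG, hdeg r.hom, mul_div_mul_comm, mul_div_mul_comm, eY, ← div_pow,
      inv_div_inv, eX]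
    refine IsOfFinOrder.mul (IsOfFinOrder.mul ?_ (hfn r.hom)) (IsOfFinOrder.pow (hfn _))
    rw [← inv_div]
    exact isOfFinOrder_inv_iff.mpr (hfn _)
  obtain ⟨t, ht, hεt⟩ := isOfFinOrder_iff_pow_eq_one.mp key
  have hX : (objMap (hF₂ := hF) G' X : Perfection hF) = objMap (hF₂ := hF) G X :=
    Perfection.ext (hobj X.obj) rfl
  have hY : (objMap (hF₂ := hF) G' Y : Perfection hF) = objMap (hF₂ := hF) G Y :=
    Perfection.ext (hobj Y.obj) rfl
  refine heq_mk_of_fn_eq_mul hX hY (repMap hG' r) (repMap hG r) rfl rfl ?_ (div_mul_cancel _ _).symm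
    (t := ⟨t, ht⟩) hεt
  rw [deg_repMap_hom hG', deg_repMap_hom hG, hdeg]

end Rigidity

end FrakCat

end GlobalFrobenioidModels

end Literature.IUT.LogThetaLattice
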